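import Summits.Ventures.HodgeRepro.Night3GSetFormGram
import Summits.Ventures.HodgeRepro.Night3GSetWeilModel

/-!
# The explicit witness of Lemma P step (2): the sum of the lines pairs non-trivially with every line

Blind re-derivation cell `pub-hodge-repro`, seat `night-3` (gen 5, row 4; NIGHT3.md §11.7).  Imports this gen's
`Night3GSetFormGram` (the monomial Gram matrix of the concrete form) and gen 4's `Night3GSetWeilModel` (the concrete
Weil space `weilSpace M = span {line |M| σ}`).  Namespace `HodgeRepro.Night3.GSetModel`.

Gen 2's cancellation step (`WeilModelKP.alg_cancel`) chooses, by `LemmaP.exists_mem_forall_ne_zero` over an infinite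
field, SOME `y ∈ W_F(B_N)` with `Q_N(ℓ_σ, y) ≠ 0` for every `σ`.  With the concrete form the witness is EXPLICIT:
`sumLines n = ∑_τ ℓ_τ` — by the monomial Gram matrix `Qc(ℓ_σ, ∑_τ ℓ_τ) = Qc(ℓ_σ, ℓ_{cσ}) ≠ 0`
(**`Qc_line_sumLines_ne_zero`**), and `sumLines |M| ∈ weilSpace M` (**`sumLines_mem_weilSpace`**).  READING: the sum
of the eigenline generators is the natural `F`-rational element of the Weil space (the trace element) — the
`ℚ`-structure itself is not modelled here (`K = L = ℂ`).  Nothing here closes S4; nothing here says anything about the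
status of the Hodge conjecture for CM abelian varieties, which is NOT proved.
-/

set_option autoImplicit false
open Finset Module
open scoped Pointwise
namespace HodgeRepro.Night3.GSetModel

variable {G : Type*} [Group G] [Fintype G] [DecidableEq G] [LinearOrder G]

/-- **The sum of all lines** `∑_τ ℓ_τ ∈ H^n(B, ℂ)` — the explicit witness of Lemma P step (2). -/
noncomputable def sumLines (n : ℕ) : Hn G n := ∑ τ : G, line n τ

omit [Group G] [LinearOrder G] in
/-- The sum of the lines lies in the concrete Weil space. -/
theorem sumLines_mem_weilSpace (M : Multiset (Finset G)) : sumLines (Multiset.card M) ∈ weilSpace M :=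
  Submodule.sum_mem _ fun τ _ => Submodule.subset_span ⟨τ, rfl⟩

/-- **`Qc(ℓ_σ, ∑_τ ℓ_τ) = Qc(ℓ_σ, ℓ_{cσ})`**: only the conjugate line contributes (the monomial Gram matrix). -/
theorem Qc_line_sumLines {c : G} (hc : IsComplexConj c) {Φ₀ : Finset G} (hΦ : IsCMType c Φ₀) {n : ℕ}
    (a : Fin n → G → ℂ) (hn : 0 < n) (σ : G) :
    Qc hc hΦ a (line n σ) (sumLines n) = Qc hc hΦ a (line n σ) (line n (c * σ)) := by
  rw [sumLines, map_sum, Finset.sum_eq_single (c * σ)]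
  · intro τ _ hτ
    exact Qc_line_line_eq_zero_of_ne hc hΦ a hn hτ
  · intro h
    exact absurd (mem_univ _) h

/-- **THE EXPLICIT WITNESS**: the sum of the lines pairs non-trivially with every line. -/
theorem Qc_line_sumLines_ne_zero {c : G} (hc : IsComplexConj c) {Φ₀ : Finset G} (hΦ : IsCMType c Φ₀) {n : ℕ}
    (a : Fin n → G → ℂ) (ha : ∀ i ρ, ρ ∈ Φ₀ → a i ρ ≠ 0) (hn : 0 < n) (σ : G) :
    Qc hc hΦ a (line n σ) (sumLines n) ≠ 0 := by
  rw [Qc_line_sumLines hc hΦ a hn σ]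
  exact Qc_line_line_conj_ne_zero hc hΦ a ha σ

/-- The witness, for the corner product `B_N` of a non-empty `N`: an element of the concrete Weil space pairing
non-trivially with every line under the concrete form. -/
theorem exists_mem_weilSpace_forall_Qc_ne_zero {c : G} (hc : IsComplexConj c) {Φ₀ : Finset G} (hΦ : IsCMType c Φ₀)
    (N : Multiset (Finset G)) (hN : N ≠ 0) (a : Fin (Multiset.card N) → G → ℂ)
    (ha : ∀ i ρ, ρ ∈ Φ₀ → a i ρ ≠ 0) :
    ∃ y ∈ weilSpace N, ∀ σ, Qc hc hΦ a (line (Multiset.card N) σ) y ≠ 0 :=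
  ⟨sumLines _, sumLines_mem_weilSpace N, fun σ =>
    Qc_line_sumLines_ne_zero hc hΦ a ha (Multiset.card_pos.mpr hN) σ⟩

end HodgeRepro.Night3.GSetModel
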